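import Mathlib
import HarnessLib
import Literature.MathematicalPhysics.KineticTheory.LangevinChainGibbs
import Literature.Probability.Distributions.GaussianPiDensity

/-!
# Insertion identity toolbox, II: the Gibbs state is `(positions) ⊗ N(0,T)^{⊗L}`

Support file for stub `stub_insertionIdentity` (line `thermalise-then-cut-probe-insertion`, crux
`stmt-AtomisticToContinuum-11748`). For an oscillator chain with continuous potentials and
`∫ e^{−Φ(q)/T} dq < ∞`, `T > 0`, the Gibbs measure `volume.tilted(−H/T)` of `LangevinChainGibbs.lean`
is the product of the configurational Gibbs measure `Z_q⁻¹ e^{−Φ/T} dq` and of `L` i.i.d. centred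
Gaussian momenta of variance `T`; redrawing any set `K` of momenta from `N(0,T)` is induced by a
measure-preserving map, so the conditional expectation `Π_K` of the line contracts `L²(μ_T)` and is
invariant under translations of the `K`-momenta. All [folklore]. No definitions.
-/

noncomputable section

open scoped ContDiff Topology ENNReal NNReal Convolution Pointwise
open MeasureTheory ProbabilityTheory Filter Set Function
open Literature.MathematicalPhysics.KineticTheory.HeatConduction

namespace Summit.AtomisticToContinuum.FouriersLaw.Cruxes.SuperadditiveResistance.InsertionToolbox

open Literature.Probability.Distributions

variable {L : ℕ}

/-! ### The Gaussian momentum weight -/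

/-- The momentum weight `e^{-(∑_i p_i²/2)/T}` is a product of one-dimensional Gaussians.
[folklore] -/
theorem momWeight_eq_prod (T : ℝ) (p : Fin L → ℝ) :
    Real.exp (-(∑ i, p i ^ 2 / 2) / T) = ∏ i, Real.exp (-(1 / (2 * T)) * p i ^ 2) := by
  rw [← Real.exp_sum]
  congr 1
  rw [neg_div, Finset.sum_div, ← Finset.sum_neg_distrib]
  refine Finset.sum_congr rfl fun i _ => ?_
  rcases eq_or_ne T 0 with hT | hT
  · subst hT; simp
  · field_simp

/-- The momentum weight is integrable (`T > 0`). [folklore] -/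
theorem integrable_momWeight {T : ℝ} (hT : 0 < T) :
    Integrable (fun p : Fin L → ℝ => Real.exp (-(∑ i, p i ^ 2 / 2) / T)) := by
  simp_rw [momWeight_eq_prod T]
  rw [volume_pi]
  exact Integrable.fintype_prod (f := fun (_ : Fin L) (s : ℝ) => Real.exp (-(1 / (2 * T)) * s ^ 2))
    fun _ => integrable_exp_neg_mul_sq (by positivity)

/-- The momentum partition function is positive (`T > 0`). [folklore] -/
theorem integral_momWeight_pos {T : ℝ} (hT : 0 < T) :
    0 < ∫ p : Fin L → ℝ, Real.exp (-(∑ i, p i ^ 2 / 2) / T) := by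
  haveI : (volume : Measure (Fin L → ℝ)).IsOpenPosMeasure := by rw [volume_pi]; infer_instance
  refine (integral_pos_iff_support_of_nonneg (fun p => (Real.exp_pos _).le)
    (integrable_momWeight hT)).2 ?_
  have hsupp : Function.support (fun p : Fin L → ℝ => Real.exp (-(∑ i, p i ^ 2 / 2) / T)) = univ := by
    ext p; simp [(Real.exp_pos _).ne']
  rw [hsupp]
  exact isOpen_univ.measure_pos volume univ_nonempty

/-- **The i.i.d. Gaussian momenta are the normalised momentum weight**:
`⊗^L N(0, T) = (∫ e^{-(∑p²/2)/T})⁻¹ · e^{-(∑p²/2)/T} dp`. [folklore] -/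
theorem pi_gaussianReal_eq_smul_momWeight {T : ℝ} (hT : 0 < T) :
    Measure.pi (fun _ : Fin L => gaussianReal 0 T.toNNReal) =
      (ENNReal.ofReal (∫ p : Fin L → ℝ, Real.exp (-(∑ i, p i ^ 2 / 2) / T)))⁻¹ •
        (volume : Measure (Fin L → ℝ)).withDensity
          fun p => ENNReal.ofReal (Real.exp (-(∑ i, p i ^ 2 / 2) / T)) := by
  have hT0 : T.toNNReal ≠ 0 := by
    intro h
    have := Real.toNNReal_eq_zero.1 h
    linarith
  have hcoe : ((T.toNNReal : ℝ≥0) : ℝ) = T := Real.coe_toNNReal T hT.le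
  have h := pi_gaussianReal_eq_inv_smul_withDensity L hT0
  rw [hcoe] at h
  rw [h, withDensity_apply _ MeasurableSet.univ, Measure.restrict_univ,
    ofReal_integral_eq_lintegral_ofReal (integrable_momWeight hT)
      (ae_of_all _ fun p => (Real.exp_pos _).le)]

/-! ### The product structure of the Gibbs state -/

variable (P : OscillatorChain)

/-- Factorisation of the Boltzmann weight: `e^{-H/T} = e^{-Φ(q)/T} · e^{-(∑p²/2)/T}`. [folklore] -/
theorem gibbsDensity_eq_mul (L : ℕ) (T : ℝ) (x : PhaseSpace L) :
    P.gibbsDensity L T x =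
      Real.exp (-P.potential L x.1 / T) * Real.exp (-(∑ i, x.2 i ^ 2 / 2) / T) := by
  rw [OscillatorChain.gibbsDensity, P.hamiltonian_eq_kinetic_add_potential, ← Real.exp_add]
  congr 1
  ring

/-- The configurational weight `e^{-Φ/T}` is continuous for continuous potentials. [folklore] -/
theorem continuous_configWeight (hU : Continuous P.U) (hV : Continuous P.V) (L : ℕ) (T : ℝ) :
    Continuous fun q : Fin L → ℝ => Real.exp (-P.potential L q / T) := by
  unfold OscillatorChain.potential
  refine Real.continuous_exp.comp ((Continuous.neg ?_).div_const T)
  refine Continuous.add (continuous_finsetSum _ fun i _ => hU.comp (continuous_apply i))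
    (continuous_finsetSum _ fun i _ => continuous_finsetSum _ fun j _ => ?_)
  split_ifs
  · exact hV.comp ((continuous_apply j).sub (continuous_apply i))
  · exact continuous_const

/-- The Boltzmann weight is integrable as soon as the configurational weight is (`T > 0`).
[folklore] -/
theorem integrable_gibbsDensity_of_config {L : ℕ} {T : ℝ} (hT : 0 < T) (hq : Integrable fun q : Fin L → ℝ => Real.exp (-P.potential L q / T)) :
    Integrable (P.gibbsDensity L T) := by
  have h := hq.mul_prod (integrable_momWeight (L := L) hT)
  have e : (fun x : PhaseSpace L => P.gibbsDensity L T x) =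
      fun x => Real.exp (-P.potential L x.1 / T) * Real.exp (-(∑ i, x.2 i ^ 2 / 2) / T) :=
    funext fun x => gibbsDensity_eq_mul P L T x
  rw [show (P.gibbsDensity L T) = fun x => P.gibbsDensity L T x from rfl, e]
  exact h

/-- **The Gibbs state is the product of the configurational Gibbs measure and of i.i.d.
`N(0, T)` momenta** (`T > 0`, continuous potentials, `e^{-Φ/T}` integrable):
`μ_T = (Z_q⁻¹ e^{-Φ/T} dq) ⊗ N(0, T)^{⊗L}`. [folklore] -/
theorem gibbsMeasure_eq_prod (hU : Continuous P.U) (hV : Continuous P.V) {L : ℕ} {T : ℝ}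
    (hT : 0 < T) (hq : Integrable fun q : Fin L → ℝ => Real.exp (-P.potential L q / T)) :
    P.gibbsMeasure L T =
      ((ENNReal.ofReal (∫ q : Fin L → ℝ, Real.exp (-P.potential L q / T)))⁻¹ •
          (volume : Measure (Fin L → ℝ)).withDensity
            fun q => ENNReal.ofReal (Real.exp (-P.potential L q / T))).prod
        (Measure.pi fun _ : Fin L => gaussianReal 0 T.toNNReal) := by
  have hρ : Integrable (P.gibbsDensity L T) := integrable_gibbsDensity_of_config P hT hq
  have hZq : 0 < ∫ q : Fin L → ℝ, Real.exp (-P.potential L q / T) := by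
    haveI : (volume : Measure (Fin L → ℝ)).IsOpenPosMeasure := by rw [volume_pi]; infer_instance
    refine (integral_pos_iff_support_of_nonneg (fun q => (Real.exp_pos _).le) hq).2 ?_
    have hsupp : Function.support (fun q : Fin L → ℝ => Real.exp (-P.potential L q / T)) = univ := by
      ext q; simp [(Real.exp_pos _).ne']
    rw [hsupp]
    exact isOpen_univ.measure_pos volume univ_nonempty
  have hZp := integral_momWeight_pos (L := L) hT
  -- the unnormalised weight factorises as a product measure
  have hprod : (volume : Measure (PhaseSpace L)).withDensity
      (fun x => ENNReal.ofReal (P.gibbsDensity L T x)) =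
      ((volume : Measure (Fin L → ℝ)).withDensity
          fun q => ENNReal.ofReal (Real.exp (-P.potential L q / T))).prod
        ((volume : Measure (Fin L → ℝ)).withDensity
          fun p => ENNReal.ofReal (Real.exp (-(∑ i, p i ^ 2 / 2) / T))) := by
    rw [prod_withDensity ((continuous_configWeight P hU hV L T).measurable.ennreal_ofReal)
      (by fun_prop)]
    congr 1
    funext x
    rw [gibbsDensity_eq_mul P, ENNReal.ofReal_mul (Real.exp_pos _).le]
  -- the partition function factorises
  have hZ : ∫ x : PhaseSpace L, P.gibbsDensity L T x =
      (∫ q : Fin L → ℝ, Real.exp (-P.potential L q / T)) *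
        ∫ p : Fin L → ℝ, Real.exp (-(∑ i, p i ^ 2 / 2) / T) := by
    rw [← integral_prod_mul (μ := (volume : Measure (Fin L → ℝ))) (ν := (volume : Measure (Fin L → ℝ)))]
    exact integral_congr_ae (ae_of_all _ fun x => gibbsDensity_eq_mul P L T x)
  rw [P.gibbsMeasure_eq_smul_withDensity hρ, P.partitionFunction_eq_ofReal_integral hρ, hprod, hZ,
    pi_gaussianReal_eq_smul_momWeight hT, Measure.prod_smul_left, Measure.prod_smul_right, smul_smul,
    ENNReal.ofReal_mul hZq.le,
    ENNReal.mul_inv (Or.inr ENNReal.ofReal_ne_top) (Or.inl ENNReal.ofReal_ne_top)]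

/-! ### Redrawing the `K`-momenta is measure preserving

`merge`: take the coordinates in `K` from `ξ` and the others from `p`
(`fun i => if K i then ξ i else p i`); under `m^{⊗L} ⊗ m^{⊗L}` the merged vector is again
`m^{⊗L}`-distributed (coordinatewise it is `fst` or `snd` of an i.i.d. pair).
-/

/-- **Merging two independent i.i.d. vectors coordinatewise is measure preserving.** [folklore] -/
theorem measurePreserving_merge (K : Fin L → Prop) [DecidablePred K] (m : Measure ℝ)
    [IsProbabilityMeasure m] :
    MeasurePreserving
      (fun pξ : (Fin L → ℝ) × (Fin L → ℝ) => fun i => if K i then pξ.2 i else pξ.1 i)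
      ((Measure.pi fun _ : Fin L => m).prod (Measure.pi fun _ : Fin L => m))
      (Measure.pi fun _ : Fin L => m) := by
  set f : Fin L → ℝ × ℝ → ℝ := fun i => if K i then Prod.snd else Prod.fst with hf
  have hfi : ∀ i, MeasurePreserving (f i) (m.prod m) m := by
    intro i
    by_cases h : K i
    · simp only [hf, h, if_true]; exact measurePreserving_snd
    · simp only [hf, h, if_false]; exact measurePreserving_fst
  have hπ := measurePreserving_pi (fun _ : Fin L => m.prod m) (fun _ : Fin L => m) hfi
  have hA := (measurePreserving_arrowProdEquivProdArrow ℝ ℝ (Fin L) (fun _ => m) (fun _ => m)).symm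
  have hcomp := hπ.comp hA
  have e : (fun pξ : (Fin L → ℝ) × (Fin L → ℝ) => fun i => if K i then pξ.2 i else pξ.1 i) =
      (fun (a : Fin L → ℝ × ℝ) i => f i (a i)) ∘
        (MeasurableEquiv.arrowProdEquivProdArrow ℝ ℝ (Fin L)).symm := by
    funext pξ
    funext i
    simp only [Function.comp_apply, hf]
    by_cases h : K i
    · simp only [h, if_true]; rfl
    · simp only [h, if_false]; rfl
  rw [e]
  exact hcomp

/-- **Redrawing the `K`-momenta from the momentum marginal preserves any state of the form
`ν ⊗ m^{⊗L}`**: the map `((q, p), ξ) ↦ (q, merge_K(ξ, p))` pushes `(ν ⊗ m^{⊗L}) ⊗ m^{⊗L}`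
forward to `ν ⊗ m^{⊗L}`. [folklore] -/
theorem measurePreserving_redraw_prod (K : Fin L → Prop) [DecidablePred K]
    (ν : Measure (Fin L → ℝ)) [SFinite ν] (m : Measure ℝ) [IsProbabilityMeasure m] :
    MeasurePreserving
      (fun z : PhaseSpace L × (Fin L → ℝ) =>
        ((z.1.1, fun i => if K i then z.2 i else z.1.2 i) : PhaseSpace L))
      ((ν.prod (Measure.pi fun _ : Fin L => m)).prod (Measure.pi fun _ : Fin L => m))
      (ν.prod (Measure.pi fun _ : Fin L => m)) := by
  have hassoc := measurePreserving_prodAssoc ν (Measure.pi fun _ : Fin L => m)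
    (Measure.pi fun _ : Fin L => m)
  have hmap := (MeasurePreserving.id ν).prod (measurePreserving_merge K m)
  have hcomp := hmap.comp hassoc
  have e : (fun z : PhaseSpace L × (Fin L → ℝ) =>
      ((z.1.1, fun i => if K i then z.2 i else z.1.2 i) : PhaseSpace L)) =
      Prod.map id (fun pξ : (Fin L → ℝ) × (Fin L → ℝ) => fun i => if K i then pξ.2 i else pξ.1 i) ∘
        (MeasurableEquiv.prodAssoc : (PhaseSpace L) × (Fin L → ℝ) ≃ᵐ
          (Fin L → ℝ) × ((Fin L → ℝ) × (Fin L → ℝ))) := by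
    funext z
    rfl
  rw [e]
  exact hcomp

/-- The configurational weight of the pinned chain is integrable for `T > 0`
(`Φ(q) ≥ ∑ ω₂ q_i²/2`). [folklore] -/
theorem pinnedChain_integrable_configWeight {ω₂ lam β : ℝ} (hω : 0 < ω₂) (hl : 0 ≤ lam)
    (hβ : 0 ≤ β) (γ : ℝ) (L : ℕ) {T : ℝ} (hT : 0 < T) :
    Integrable fun q : Fin L → ℝ => Real.exp (-(pinnedChain ω₂ lam β γ).potential L q / T) := by
  set g : (Fin L → ℝ) → ℝ := fun q => ∏ i, Real.exp (-(ω₂ / (2 * T)) * q i ^ 2) with hg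
  have hgi : Integrable g := by
    have := Integrable.fintype_prod (μ := fun _ : Fin L => (volume : Measure ℝ))
      (f := fun _ t => Real.exp (-(ω₂ / (2 * T)) * t ^ 2))
      (fun _ => integrable_exp_neg_mul_sq (by positivity))
    simpa [hg, volume_pi] using this
  have hc : Continuous fun q : Fin L → ℝ => Real.exp (-(pinnedChain ω₂ lam β γ).potential L q / T) :=
    continuous_configWeight _ (pinnedChain_contDiff_U ω₂ lam β γ (n := 0)).continuous
      (pinnedChain_contDiff_V ω₂ lam β γ (n := 0)).continuous L T
  refine hgi.mono' hc.aestronglyMeasurable (ae_of_all _ fun q => ?_)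
  rw [Real.norm_eq_abs, abs_of_pos (Real.exp_pos _)]
  -- `Φ(q) = H(q, 0) ≥ ∑ ω₂ q²/2`
  have hle := pinnedChain_harmonic_le_hamiltonian (ω₂ := ω₂) hl hβ γ L ((q, 0) : PhaseSpace L)
  rw [(pinnedChain ω₂ lam β γ).hamiltonian_eq_kinetic_add_potential] at hle
  simp only [Pi.zero_apply, ne_eq, OfNat.ofNat_ne_zero, not_false_eq_true, zero_pow, zero_div,
    Finset.sum_const_zero, add_zero, zero_add] at hle
  have : g q = Real.exp (-(∑ i, ω₂ * q i ^ 2 / 2) / T) := by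
    simp only [hg, ← Real.exp_sum]
    congr 1
    rw [neg_div, Finset.sum_div, ← Finset.sum_neg_distrib]
    exact Finset.sum_congr rfl fun i _ => by field_simp
  rw [this]
  exact Real.exp_le_exp.mpr (by
    rw [neg_div, neg_div, neg_le_neg_iff]
    exact div_le_div_of_nonneg_right hle hT.le)

/-- **Redrawing the `K`-momenta from `N(0,T)` preserves the Gibbs state of the pinned chain**
(`ω₂ > 0`, `lam, β ≥ 0`, `T > 0`): the map `((q,p), ξ) ↦ (q, merge_K(ξ, p))` pushes
`μ_T ⊗ N(0,T)^{⊗L}` forward to `μ_T`. This is the measure-theoretic content of "under `μ_T` the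
momenta are i.i.d. `N(0,T)` and independent of the positions". [folklore] -/
theorem pinnedChain_measurePreserving_redraw {ω₂ lam β : ℝ} (hω : 0 < ω₂) (hl : 0 ≤ lam)
    (hβ : 0 ≤ β) (γ : ℝ) (L : ℕ) {T : ℝ} (hT : 0 < T) (K : Fin L → Prop) [DecidablePred K] :
    MeasurePreserving
      (fun z : PhaseSpace L × (Fin L → ℝ) =>
        ((z.1.1, fun i => if K i then z.2 i else z.1.2 i) : PhaseSpace L))
      (((pinnedChain ω₂ lam β γ).gibbsMeasure L T).prod
        (Measure.pi fun _ : Fin L => gaussianReal 0 T.toNNReal))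
      ((pinnedChain ω₂ lam β γ).gibbsMeasure L T) := by
  rw [gibbsMeasure_eq_prod (pinnedChain ω₂ lam β γ)
    (pinnedChain_contDiff_U ω₂ lam β γ (n := 0)).continuous
    (pinnedChain_contDiff_V ω₂ lam β γ (n := 0)).continuous hT
    (pinnedChain_integrable_configWeight hω hl hβ γ L hT)]
  exact measurePreserving_redraw_prod K _ _

/-! ### The redraw (conditional expectation) operator `Π_K` on `L²(μ_T)`

`Π_K f (q, p) = ∫ f(q, merge_K(ξ, p)) dN(0,T)^{⊗L}(ξ)`, written inline. Everything below is a
consequence of `pinnedChain_measurePreserving_redraw`.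
-/

section CondK

variable {ω₂ lam β : ℝ}

/-- Jensen for squares on a probability space: `(∫ h)² ≤ ∫ h²` for `h ∈ L²`. [folklore] -/
theorem sq_integral_le_integral_sq {Ω : Type*} [MeasurableSpace Ω] {μ : Measure Ω}
    [IsProbabilityMeasure μ] {h : Ω → ℝ} (hh : MemLp h 2 μ) :
    (∫ x, h x ∂μ) ^ 2 ≤ ∫ x, h x ^ 2 ∂μ := by
  have h1 := variance_nonneg h μ
  rw [variance_eq_sub hh] at h1
  simp only [Pi.pow_apply] at h1
  linarith

/-- `Π_K f` is invariant under translations of the momenta in `K` (pointwise, for every `f`).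
[folklore] -/
theorem condK_add_smul (L : ℕ) (K : Fin L → Prop) [DecidablePred K] (ν : Measure (Fin L → ℝ))
    (f : PhaseSpace L → ℝ) (x : PhaseSpace L) (t : ℝ) {i : Fin L} (hi : K i) :
    (∫ ξ, f ((x + t • ((0, Pi.single i 1) : PhaseSpace L)).1,
        fun j => if K j then ξ j else (x + t • ((0, Pi.single i 1) : PhaseSpace L)).2 j) ∂ν) =
      ∫ ξ, f (x.1, fun j => if K j then ξ j else x.2 j) ∂ν := by
  congr 1
  funext ξ
  congr 1
  rw [add_smul_unitP_fst]
  congr 1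
  funext j
  by_cases hj : K j
  · simp [hj]
  · have hji : j ≠ i := fun h => hj (h ▸ hi)
    simp [hj, hji]

variable (hω : 0 < ω₂) (hl : 0 ≤ lam) (hβ : 0 ≤ β) (γ : ℝ) (L : ℕ) {T : ℝ} (hT : 0 < T)
  (K : Fin L → Prop) [DecidablePred K]
include hω hl hβ hT

/-- **`Π_K` contracts `L²(μ_T)`**: `∫ (Π_K f)² dμ_T ≤ ∫ f² dμ_T`, and `Π_K f ∈ L²(μ_T)`. [folklore] -/
theorem memLp_condK_and_integral_sq_le {f : PhaseSpace L → ℝ}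
    (hf : MemLp f 2 ((pinnedChain ω₂ lam β γ).gibbsMeasure L T)) :
    MemLp (fun x : PhaseSpace L =>
        ∫ ξ, f (x.1, fun i => if K i then ξ i else x.2 i)
          ∂(Measure.pi fun _ : Fin L => gaussianReal 0 T.toNNReal)) 2
      ((pinnedChain ω₂ lam β γ).gibbsMeasure L T) ∧
    ∫ x, (∫ ξ, f (x.1, fun i => if K i then ξ i else x.2 i)
        ∂(Measure.pi fun _ : Fin L => gaussianReal 0 T.toNNReal)) ^ 2
        ∂((pinnedChain ω₂ lam β γ).gibbsMeasure L T) ≤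
      ∫ x, f x ^ 2 ∂((pinnedChain ω₂ lam β γ).gibbsMeasure L T) := by
  haveI := pinnedChain_isProbabilityMeasure_gibbsMeasure hω hl hβ γ L hT
  set μ := (pinnedChain ω₂ lam β γ).gibbsMeasure L T with hμ
  set γL : Measure (Fin L → ℝ) := Measure.pi fun _ : Fin L => gaussianReal 0 T.toNNReal with hγL
  have hΨ := pinnedChain_measurePreserving_redraw hω hl hβ γ L hT K
  set F : PhaseSpace L × (Fin L → ℝ) → ℝ :=
    fun z => f (z.1.1, fun i => if K i then z.2 i else z.1.2 i) with hF
  have hL2 : MemLp F 2 (μ.prod γL) := hf.comp_measurePreserving hΨ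
  have hsq : Integrable (fun z => F z ^ 2) (μ.prod γL) := (memLp_two_iff_integrable_sq hL2.1).mp hL2
  have hmeas : AEStronglyMeasurable (fun x : PhaseSpace L => ∫ ξ, F (x, ξ) ∂γL) μ :=
    hL2.1.integral_prod_right'
  -- fibrewise Jensen, a.e.
  have hjensen : ∀ᵐ x ∂μ, (∫ ξ, F (x, ξ) ∂γL) ^ 2 ≤ ∫ ξ, F (x, ξ) ^ 2 ∂γL := by
    filter_upwards [hsq.prod_right_ae, hL2.1.prodMk_left] with x hx hxm
    have hfib : MemLp (fun ξ => F (x, ξ)) 2 γL := (memLp_two_iff_integrable_sq hxm).mpr hx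
    exact sq_integral_le_integral_sq hfib
  have hG : Integrable (fun x : PhaseSpace L => ∫ ξ, F (x, ξ) ^ 2 ∂γL) μ := hsq.integral_prod_left
  have hdom : Integrable (fun x : PhaseSpace L => (∫ ξ, F (x, ξ) ∂γL) ^ 2) μ := by
    refine hG.mono' (hmeas.pow 2) ?_
    filter_upwards [hjensen] with x hx
    rw [Real.norm_eq_abs, abs_of_nonneg (sq_nonneg _)]
    exact hx
  have hPi : MemLp (fun x : PhaseSpace L => ∫ ξ, F (x, ξ) ∂γL) 2 μ :=
    (memLp_two_iff_integrable_sq hmeas).mpr hdom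
  refine ⟨hPi, ?_⟩
  calc ∫ x, (∫ ξ, F (x, ξ) ∂γL) ^ 2 ∂μ ≤ ∫ x, (∫ ξ, F (x, ξ) ^ 2 ∂γL) ∂μ :=
        integral_mono_ae hdom hG hjensen
    _ = ∫ z, F z ^ 2 ∂(μ.prod γL) := (integral_prod _ hsq).symm
    _ = ∫ x, f x ^ 2 ∂μ := by
        have e := integral_map (μ := μ.prod γL) hΨ.measurable.aemeasurable (f := fun x => f x ^ 2)
          (by rw [hΨ.map_eq]; exact hf.1.pow 2)
        rw [hΨ.map_eq] at e
        rw [e]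

end CondK

/-- Registered helper stub of this support file: redrawing the `K`-momenta from `N(0,T)` preserves the Gibbs state of the pinned chain. [folklore] -/
theorem helper_insertionGibbsProduct : ∀ {ω₂ lam β : ℝ}, 0 < ω₂ → 0 ≤ lam → 0 ≤ β → ∀ (γ : ℝ) (L : ℕ) {T : ℝ}, 0 < T → ∀ (K : Fin L → Prop) [DecidablePred K], MeasurePreserving (fun z : PhaseSpace L × (Fin L → ℝ) => ((z.1.1, fun i => if K i then z.2 i else z.1.2 i) : PhaseSpace L)) (((pinnedChain ω₂ lam β γ).gibbsMeasure L T).prod (Measure.pi fun _ : Fin L => gaussianReal 0 T.toNNReal)) ((pinnedChain ω₂ lam β γ).gibbsMeasure L T) := by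
  intro ω₂ lam β hω hl hβ γ L T hT K _
  exact pinnedChain_measurePreserving_redraw hω hl hβ γ L hT K

end Summit.AtomisticToContinuum.FouriersLaw.Cruxes.SuperadditiveResistance.InsertionToolbox

end
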